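import Literature.InformationTheory.QuantumCodes.CorrectableRegions
import HarnessLib

/-!
# Subsystem (operator) stabilizer codes in the symplectic picture; the Cleaning Lemma for subsystem codes

Sources (all read via `lit`).

* S. Bravyi, B. Terhal, arXiv:0810.1983 [BravyiTerhal2009], §1.3 (chunks p0006 L98–110, p0007 L1–47): «a subsystem
  code can be characterized by its gauge group … `𝒢` … The symmetries of the Hamiltonian … are described by the
  centralizer of `𝒢` … `𝒞(𝒢) = ⟨𝒮, X̄_j, Z̄_j, j = 1,…,k⟩`, where `𝒮` is the center of the gauge group, i.e.
  `𝒮 = 𝒢 ∩ 𝒞(𝒢)` … The group `𝒮` is called a stabilizer group of the subsystem code … for (subspace) stabilizer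
  codes the stabilizer group `𝒮` coincides with the gauge group `𝒢`. The distance `d` of a subsystem code is
  defined as … `d = min_{P ∈ 𝒞(𝒮)∖𝒢} |P|` … a useful identity `𝒞(𝒮) = 𝒢 · 𝒞(𝒢)`»; §3.1 Lemma 2 (p0011 L8–30):
  «(Cleaning Lemma for Subsystem Codes). Let `𝒢` be a gauge group of a subsystem code and `M` be an arbitrary subset
  of qubits. Then one of the following is true: (1) There exists a non-trivial logical operator `P ∈ 𝒞(𝒮)∖𝒢` whose
  support is contained in `M`, (2) For any logical operator `P ∈ 𝒞(𝒢)` one can choose a stabilizer `S ∈ 𝒮` such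
  that `PS` acts trivially on `M`.»
* S. Bravyi, arXiv:1008.1029 [Bravyi2011Subsystem], §6 (chunk p0011 L40–128): «`𝒞(𝒞(𝒢)) = 𝒢` and
  `dim 𝒞(𝒢) + dim 𝒢 = 2n`»; «`l(M) = dim 𝒞(𝒮_M) ∩ 𝒫(M) − dim 𝒢(M)`» (independent dressed logical operators
  supported inside `M`), «`l_bare(M) = dim 𝒞(𝒢_M) ∩ 𝒫(M) − dim 𝒮(M)`»; «Lemma 2. Suppose a subsystem code `𝒢` has
  `k` logical qubits. Then `l_bare(M) + l(M̄) = 2k` for any subset of qubits `M ⊆ Λ`. It can also be regarded as a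
  generalization of the “Cleaning Lemma” proved for subsystem codes in [BT08] … Specializing … to stabilizer codes
  (`𝒢 = 𝒮`) one gets … `l(M) + l(M̄) = 2k` [Yoshida–Chuang].»
* J. Haah, J. Preskill, arXiv:1011.3529 [HaahPreskill2012], §3 (chunk p0005 L1–60): the same objects as vector
  spaces, `g_bare(M) = [(G⊥)_M / S_M]`, `g(M) = [(S⊥)_M / G_M]`, Lemma 2 «`g_bare(M) + g(M^c) = 2k`», and §4 (p0007
  L14): «a region … `M` is said to be correctable if no nontrivial dressed logical operation is supported on `M`».

In the tree's vocabulary (`SymplecticCodes.lean`: a Pauli operator is its class `(a|b) ∈ 𝔽₂^{2n} = SympVec n`,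
commutation = `sympInner = 0`, `𝒞(𝒢)` modulo phases = `sympDual Ḡ`) a **subsystem code** is an ARBITRARY subspace
`Ḡ ≤ 𝔽₂^{2n}` (the gauge group modulo phases); this file introduces

* `gaugeStabilizer Ḡ = Ḡ ⊓ Ḡ⊥` (the stabilizer group `𝒮 = 𝒢 ∩ 𝒞(𝒢)` modulo phases),
* `HasSubsystemMinDist Ḡ d` («no dressed logical operator `P ∈ 𝒞(𝒮)∖𝒢` of weight `< d`») and
  `IsSubsystemCode Ḡ k d` (`dim Ḡ⊥ = dim S̄ + 2k` logical qubits and minimum distance `≥ d`),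
* `IsGaugeCorrectable Ḡ M` («no nontrivial dressed logical operation is supported on `M`»),

and PROVES: the basic lattice facts (`S̄ ≤ Ḡ ≤ S̄⊥`, `S̄ ≤ Ḡ⊥ ≤ S̄⊥`, `S̄` self-orthogonal), BT09's «useful
identity» `S̄⊥ = Ḡ ⊔ Ḡ⊥` (`sympDual_gaugeStabilizer`), the stabilizer case (`Ḡ` self-orthogonal ⇔ `S̄ = Ḡ`, and
`IsAdditiveCode ⇒ IsSubsystemCode`), the COUNT `l_bare(M) + l(M̄) = 2k` of Bravyi 2011 Lemma 2 / Haah–Preskill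
Lemma 2 in subtraction-free form (`bareDressed_count`: `[Ḡ⊥_M] + [S̄⊥_{M̄}] + [S̄] = [S̄_M] + [Ḡ_{M̄}] + [Ḡ⊥]`, from
the tree's exact cleaning count `finrank_sympDual_inf_supportedOn_add` applied to `Ḡ` and to `S̄`), and the two
CLEANING forms: BT09 Lemma 2 as printed (`BravyiTerhal2009_lemma2`: a dressed logical operator on `M`, or every
bare logical operator is cleaned off `M` by a stabilizer) and the gauge-cleaning form used by Haah–Preskill Thm. 1
(`sup_gauge_dressed_compl_eq`: no bare logical operator on `M` ⇒ `Ḡ ⊔ (S̄⊥ ⊓ 𝒫(M̄)) = S̄⊥`).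

No `sorry`, no new axioms, no named facts. Deliberately NOT here: the Hilbert-space side (`ℒ = ℒ_logical ⊗ ℒ_gauge`),
gauge qubit count `g`, CSS subsystem codes (HP12 Lemma 2, CSS form), Bacon–Shor and Bravyi's generalized Bacon–Shor
codes (Thm. 2 of [Bravyi2011Subsystem]), the bounds `kd = O(n)` / `d = O(L^{D−1})` for local subsystem codes
([Bravyi2011Subsystem] Eq. (2), [BravyiTerhal2009] Thm. 1*) — later files on top of this vocabulary.

## Mathlib / tree search

Tree: `sympDual`, `sympDual_sympDual`, `sympDual_anti`, `finrank_sympDual_add`, `IsSelfOrthogonal`, `HasMinDist`,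
`IsAdditiveCode`, `IsAdditiveCode.finrank_sympDual` (SymplecticCodes.lean); `supportedOn`, `sympWeight_le_card_of_mem`
(QuantumSingletonBound.lean); `IsCorrectableRegion`, `supportedOn_mono`, `finrank_sympDual_inf_supportedOn_add`
(CorrectableRegions.lean). No subsystem-code notion existed (`rg -i "subsystem|gauge group|gaugeStabilizer"` over
Literature: prose mentions only). Mathlib has no stabilizer / subsystem code notions.
-/

namespace Literature.InformationTheory.QuantumCodes

open Finset Module

variable {n : ℕ}

/-- `s + q + s = q` in `𝔽₂^{2n}`. [folklore] -/
private theorem add_add_cancel_right (s q : SympVec n) : s + q + s = q := by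
  ext i
  · show s.1 i + q.1 i + s.1 i = q.1 i
    rw [add_right_comm, CharTwo.add_self_eq_zero, zero_add]
  · show s.2 i + q.2 i + s.2 i = q.2 i
    rw [add_right_comm, CharTwo.add_self_eq_zero, zero_add]

/-! ### The objects -/

/-- **Stabilizer group of a subsystem code** (modulo phases): «`𝒮` is the center of the gauge group, i.e.
`𝒮 = 𝒢 ∩ 𝒞(𝒢)`» — for a gauge space `Ḡ ≤ 𝔽₂^{2n}`, `S̄ = Ḡ ⊓ Ḡ⊥`. Column: definition.
[cite: BravyiTerhal2009, §1.3 (p. 7: «𝒮 = 𝒢 ∩ 𝒞(𝒢) … is called a stabilizer group of the subsystem code»)] -/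
def gaugeStabilizer (G : Submodule (ZMod 2) (SympVec n)) : Submodule (ZMod 2) (SympVec n) := G ⊓ sympDual G

/-- **Minimum distance `≥ d` of a subsystem code**: «`d = min_{P ∈ 𝒞(𝒮)∖𝒢} |P|`» — every DRESSED logical operator
(an element of `S̄⊥` outside `Ḡ`) has weight `≥ d`. Column: definition.
[cite: BravyiTerhal2009, §1.3 (p. 7, Eq. (subsystemd): «d = min_{P ∈ 𝒞(𝒮)∖𝒢} |P|, 𝒮 = 𝒢 ∩ 𝒞(𝒢)»)] -/
def HasSubsystemMinDist (G : Submodule (ZMod 2) (SympVec n)) (d : ℕ) : Prop :=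
  ∀ v ∈ sympDual (gaugeStabilizer G), v ∉ G → d ≤ sympWeight v

/-- **Subsystem code with `k` logical qubits and minimum distance `≥ d`**: the gauge space `Ḡ` (any subspace of
`𝔽₂^{2n}`) has `dim Ḡ⊥ = dim S̄ + 2k` («`𝒞(𝒢) = ⟨𝒮, X̄_j, Z̄_j, j = 1,…,k⟩`»: the bare logical Pauli group on `k`
qubits) and no dressed logical operator of weight `< d`. For `Ḡ` self-orthogonal this is the stabilizer code `Ḡ`
(`IsAdditiveCode.isSubsystemCode`). Column: definition.
[cite: BravyiTerhal2009, §1.3 (p. 7: «𝒞(𝒢) = ⟨𝒮, X̄_j, Z̄_j, j=1,…,k⟩ … dim(ℒ_logical) = 2^k»; distance Eq. (subsystemd))] -/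
def IsSubsystemCode (G : Submodule (ZMod 2) (SympVec n)) (k d : ℕ) : Prop :=
  finrank (ZMod 2) (sympDual G) = finrank (ZMod 2) (gaugeStabilizer G) + 2 * k ∧ HasSubsystemMinDist G d

/-- **Correctable region of a subsystem code**: «a region (i.e., set of qubits) `M` is said to be correctable if no
nontrivial dressed logical operation is supported on `M`» — `S̄⊥ ∩ 𝒫(M) ⊆ Ḡ` (Bravyi: `l(M) = 0`). Column: definition.
[cite: HaahPreskill2012, §4 (p. 7: «M is said to be correctable if no nontrivial dressed logical operation is supported on M»)] -/
def IsGaugeCorrectable (G : Submodule (ZMod 2) (SympVec n)) (M : Finset (Fin n)) : Prop :=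
  ∀ v ∈ sympDual (gaugeStabilizer G), v ∈ supportedOn M → v ∈ G

/-! ### The lattice of a subsystem code: `S̄ ≤ Ḡ, Ḡ⊥ ≤ S̄⊥ = Ḡ ⊔ Ḡ⊥` -/

section Lattice

variable (G : Submodule (ZMod 2) (SympVec n))

/-- `S̄ ≤ Ḡ`. [cite: BravyiTerhal2009, §1.3 (𝒮 = 𝒢 ∩ 𝒞(𝒢))] -/
theorem gaugeStabilizer_le : gaugeStabilizer G ≤ G := inf_le_left

/-- `S̄ ≤ Ḡ⊥` (stabilizers commute with every gauge operator). [cite: BravyiTerhal2009, §1.3 (𝒮 = 𝒢 ∩ 𝒞(𝒢))] -/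
theorem gaugeStabilizer_le_sympDual : gaugeStabilizer G ≤ sympDual G := inf_le_right

/-- `Ḡ⊥ ≤ S̄⊥` (`𝒞(𝒢) ⊆ 𝒞(𝒮)`: bare logical operators are dressed logical operators).
[cite: BravyiTerhal2009, §1.3 and p. 13 («bare» logical operators 𝒞(𝒢)∖𝒢 inside 𝒞(𝒮)∖𝒢)] -/
theorem sympDual_le_sympDual_gaugeStabilizer : sympDual G ≤ sympDual (gaugeStabilizer G) :=
  sympDual_anti (gaugeStabilizer_le G)

/-- `Ḡ ≤ S̄⊥` (gauge operators commute with the stabilizers). [cite: BravyiTerhal2009, §1.3 (𝒞(𝒮) = 𝒢·𝒞(𝒢) ⊇ 𝒢)] -/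
theorem le_sympDual_gaugeStabilizer : G ≤ sympDual (gaugeStabilizer G) := by
  have h := sympDual_anti (gaugeStabilizer_le_sympDual G)
  rwa [sympDual_sympDual] at h

/-- The stabilizer group of a subsystem code is abelian: `S̄ ≤ S̄⊥`. [cite: BravyiTerhal2009, §1.3 («𝒮 is the center of the gauge group»)] -/
theorem isSelfOrthogonal_gaugeStabilizer : IsSelfOrthogonal (gaugeStabilizer G) :=
  (gaugeStabilizer_le G).trans (le_sympDual_gaugeStabilizer G)

/-- «`dim 𝒞(𝒢) + dim 𝒢 = 2n`» (the tree's `finrank_sympDual_add`, recorded for the subsystem setting).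
[cite: Bravyi2011Subsystem, §6 (p. 11: «dim 𝒞(𝒢) + dim 𝒢 = 2n for any subgroup 𝒢»)] -/
theorem finrank_sympDual_add_finrank_gauge :
    finrank (ZMod 2) (sympDual G) + finrank (ZMod 2) G = 2 * n :=
  finrank_sympDual_add G

/-- **BT09's «useful identity» `𝒞(𝒮) = 𝒢 · 𝒞(𝒢)`**: `S̄⊥ = Ḡ ⊔ Ḡ⊥` (dressed logical = gauge × bare logical).
[cite: BravyiTerhal2009, §1.3 (p. 7, Eq. (useful_identity): «𝒞(𝒮) = 𝒢·𝒞(𝒢) that holds for any subsystem code 𝒢»)] -/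
theorem sympDual_gaugeStabilizer : sympDual (gaugeStabilizer G) = G ⊔ sympDual G := by
  symm
  refine Submodule.eq_of_le_of_finrank_le
    (sup_le (le_sympDual_gaugeStabilizer G) (sympDual_le_sympDual_gaugeStabilizer G)) ?_
  have h1 := Submodule.finrank_sup_add_finrank_inf_eq G (sympDual G)
  have h2 := finrank_sympDual_add G
  have h3 := finrank_sympDual_add (gaugeStabilizer G)
  unfold gaugeStabilizer at h3 ⊢
  omega

/-- `dim S̄⊥ + dim Ḡ = dim Ḡ⊥ + dim S̄ + 2(dim Ḡ − dim S̄)`, i.e. `dim S̄⊥ − dim Ḡ = dim Ḡ⊥ − dim S̄`: the logical-qubit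
count `2k` can be read on the bare or on the dressed side. [cite: HaahPreskill2012, §3 (p. 5: g_bare, g and «[G⊥] − [S] = 2k»)] -/
theorem finrank_sympDual_gaugeStabilizer_add :
    finrank (ZMod 2) (sympDual (gaugeStabilizer G)) + finrank (ZMod 2) (gaugeStabilizer G) =
      finrank (ZMod 2) (sympDual G) + finrank (ZMod 2) G := by
  have h2 := finrank_sympDual_add G
  have h3 := finrank_sympDual_add (gaugeStabilizer G)
  omega

end Lattice

/-! ### The stabilizer case `Ḡ = S̄` -/

section StabilizerCase

variable {G : Submodule (ZMod 2) (SympVec n)}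

/-- «For (subspace) stabilizer codes the stabilizer group `𝒮` coincides with the gauge group `𝒢`»: a self-orthogonal
gauge space is its own stabilizer space. [cite: BravyiTerhal2009, §1.3 (p. 7)] -/
theorem gaugeStabilizer_eq_self_of_isSelfOrthogonal (h : IsSelfOrthogonal G) : gaugeStabilizer G = G :=
  inf_eq_left.2 h

/-- Conversely, `S̄ = Ḡ` forces `Ḡ` self-orthogonal (an abelian gauge group: no gauge qubits).
[cite: BravyiTerhal2009, §1.3 (p. 7: «Subsystem codes with an Abelian gauge group have no gauge qubits … coincide with the (subspace) stabilizer codes»)] -/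
theorem isSelfOrthogonal_of_gaugeStabilizer_eq_self (h : gaugeStabilizer G = G) : IsSelfOrthogonal G := by
  have := gaugeStabilizer_le_sympDual G
  rwa [h] at this

/-- A stabilizer code `S̄` with parameters `((n, 2^k, d))` is a subsystem code with gauge space `S̄`, `k` logical
qubits and minimum distance `≥ d`. [cite: BravyiTerhal2009, §1.3 (p. 7: stabilizer codes as the case 𝒮 = 𝒢)] -/
theorem IsAdditiveCode.isSubsystemCode {k d : ℕ} (h : IsAdditiveCode G k d) : IsSubsystemCode G k d := by
  have hS : gaugeStabilizer G = G := gaugeStabilizer_eq_self_of_isSelfOrthogonal h.1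
  refine ⟨?_, fun v hv hvG => ?_⟩
  · rw [hS, h.finrank_sympDual]
    have := h.2.1
    omega
  · rw [hS] at hv
    exact h.2.2.1 v hv hvG

/-- For a stabilizer code the two notions of correctable region agree.
[cite: HaahPreskill2012, §4 (p. 7) with BravyiTerhal2009 §2 (correctable regions of stabilizer codes)] -/
theorem isGaugeCorrectable_iff_of_isSelfOrthogonal (h : IsSelfOrthogonal G) (M : Finset (Fin n)) :
    IsGaugeCorrectable G M ↔ IsCorrectableRegion G M := by
  unfold IsGaugeCorrectable IsCorrectableRegion
  rw [gaugeStabilizer_eq_self_of_isSelfOrthogonal h]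

end StabilizerCase

/-! ### Two extreme examples (non-vacuity) -/

section Examples

/-- The trivial gauge group (`𝒢 = ⟨iI⟩`, no stabilizers, nothing gauged): `n` logical qubits, distance `1`.
[cite: BravyiTerhal2009, §1.3 (p. 7: the case 𝒮 = ⟨I⟩)] -/
theorem isSubsystemCode_bot (n : ℕ) : IsSubsystemCode (⊥ : Submodule (ZMod 2) (SympVec n)) n 1 :=
  (isAdditiveCode_bot n).isSubsystemCode

/-- The full Pauli group as gauge group (every qubit a gauge qubit): stabilizer space `⊥`, `k = 0` logical qubits,
and no dressed logical operator at all (every `d` is admitted). [cite: BravyiTerhal2009, §1.3 (p. 7: gauge qubits vs logical qubits, n = dim count)] -/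
theorem isSubsystemCode_top (n d : ℕ) : IsSubsystemCode (⊤ : Submodule (ZMod 2) (SympVec n)) 0 d := by
  have htop : sympDual (⊤ : Submodule (ZMod 2) (SympVec n)) = ⊥ := by
    rw [← sympDual_bot, sympDual_sympDual]
  have hS : gaugeStabilizer (⊤ : Submodule (ZMod 2) (SympVec n)) = ⊥ := by
    unfold gaugeStabilizer; rw [htop, inf_bot_eq]
  refine ⟨by rw [hS, htop, mul_zero, add_zero], fun v _ hv => absurd Submodule.mem_top hv⟩

end Examples

/-! ### Correctable regions -/

section Correctable

variable {G : Submodule (ZMod 2) (SympVec n)}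

/-- Lattice form: `M` is correctable iff `S̄⊥ ⊓ 𝒫(M) ≤ Ḡ` (Bravyi's `l(M) = 0`).
[cite: Bravyi2011Subsystem, §6 (p. 11: l(M), «the number of independent dressed logical operators supported inside M»)] -/
theorem isGaugeCorrectable_iff_inf_le {M : Finset (Fin n)} :
    IsGaugeCorrectable G M ↔
      (sympDual (gaugeStabilizer G) ⊓ supportedOn M : Submodule (ZMod 2) (SympVec n)) ≤ G :=
  ⟨fun h _ hv => h _ hv.1 hv.2, fun h _ hv hvM => h ⟨hv, hvM⟩⟩

/-- «`M` is certainly correctable if `|M| < d`.» [cite: HaahPreskill2012, §4 (p. 7)] -/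
theorem IsGaugeCorrectable.of_card_lt {d : ℕ} (hd : HasSubsystemMinDist G d) {M : Finset (Fin n)}
    (hM : #M < d) : IsGaugeCorrectable G M := by
  intro v hv hvM
  by_contra hvG
  have h1 := hd v hv hvG
  have h2 := sympWeight_le_card_of_mem hvM
  omega

/-- Sub-regions of correctable regions are correctable. [cite: HaahPreskill2012, §4 (p. 7)] -/
theorem IsGaugeCorrectable.mono {M M' : Finset (Fin n)} (h : IsGaugeCorrectable G M) (hM' : M' ⊆ M) :
    IsGaugeCorrectable G M' :=
  fun v hv hvM' => h v hv (supportedOn_mono hM' hvM')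

end Correctable

/-! ### The Cleaning Lemma for subsystem codes -/

section Cleaning

variable (G : Submodule (ZMod 2) (SympVec n)) (M : Finset (Fin n))

/-- **Bravyi 2011 Lemma 2 / Haah–Preskill Lemma 2 — the count `l_bare(M) + l(M̄) = 2k`, proved** in the
subtraction-free form `dim(Ḡ⊥ ∩ 𝒫(M)) + dim(S̄⊥ ∩ 𝒫(M̄)) + dim S̄ = dim(S̄ ∩ 𝒫(M)) + dim(Ḡ ∩ 𝒫(M̄)) + dim Ḡ⊥`
(with `l_bare(M) = dim(Ḡ⊥ ∩ 𝒫(M)) − dim(S̄ ∩ 𝒫(M))`, `l(M̄) = dim(S̄⊥ ∩ 𝒫(M̄)) − dim(Ḡ ∩ 𝒫(M̄))`,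
`2k = dim Ḡ⊥ − dim S̄`): the tree's exact cleaning count `dim T̄⊥(A) + dim T̄ = 2|A| + dim T̄(Ā)` for `(T̄, A) = (Ḡ, M)`
and `(S̄, M̄)`, plus `dim Ḡ + dim Ḡ⊥ = 2n`. Column: proved theorem.
[cite: Bravyi2011Subsystem, §6 Lemma 2 (p. 11: «l_bare(M) + l(M̄) = 2k for any subset of qubits M»); HaahPreskill2012, §3 Lemma 2 («g_bare(M) + g(M^c) = 2k»)] -/
theorem bareDressed_count :
    finrank (ZMod 2) (sympDual G ⊓ supportedOn M : Submodule (ZMod 2) (SympVec n)) +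
        finrank (ZMod 2) (sympDual (gaugeStabilizer G) ⊓ supportedOn Mᶜ : Submodule (ZMod 2) (SympVec n)) +
          finrank (ZMod 2) (gaugeStabilizer G) =
      finrank (ZMod 2) (gaugeStabilizer G ⊓ supportedOn M : Submodule (ZMod 2) (SympVec n)) +
        finrank (ZMod 2) (G ⊓ supportedOn Mᶜ : Submodule (ZMod 2) (SympVec n)) +
          finrank (ZMod 2) (sympDual G) := by
  have hG := finrank_sympDual_inf_supportedOn_add G M
  have hS := finrank_sympDual_inf_supportedOn_add (gaugeStabilizer G) Mᶜ
  rw [compl_compl] at hS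
  have h2 := finrank_sympDual_add G
  have hc : #(Mᶜ : Finset (Fin n)) + #M = n := by
    rw [Finset.card_compl, Fintype.card_fin]
    have := Finset.card_le_univ M
    rw [Fintype.card_fin] at this
    omega
  omega

/-- **The count with `k`**: for a subsystem code with `k` logical qubits, `l_bare(M) + l(M̄) = 2k`, i.e.
`dim(Ḡ⊥ ∩ 𝒫(M)) + dim(S̄⊥ ∩ 𝒫(M̄)) = dim(S̄ ∩ 𝒫(M)) + dim(Ḡ ∩ 𝒫(M̄)) + 2k`.
[cite: Bravyi2011Subsystem, §6 Lemma 2 (p. 11); HaahPreskill2012, §3 Lemma 2] -/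
theorem IsSubsystemCode.bareDressed_count {G : Submodule (ZMod 2) (SympVec n)} {k d : ℕ}
    (h : IsSubsystemCode G k d) (M : Finset (Fin n)) :
    finrank (ZMod 2) (sympDual G ⊓ supportedOn M : Submodule (ZMod 2) (SympVec n)) +
        finrank (ZMod 2) (sympDual (gaugeStabilizer G) ⊓ supportedOn Mᶜ : Submodule (ZMod 2) (SympVec n)) =
      finrank (ZMod 2) (gaugeStabilizer G ⊓ supportedOn M : Submodule (ZMod 2) (SympVec n)) +
        finrank (ZMod 2) (G ⊓ supportedOn Mᶜ : Submodule (ZMod 2) (SympVec n)) + 2 * k := by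
  have hc := Literature.InformationTheory.QuantumCodes.bareDressed_count G M
  have hk := h.1
  omega

variable {G M}

/-- **Cleaning bare logical operators with stabilizers** (BT09 Lemma 2, case (2), lattice form): if no dressed
logical operator is supported on `M` then `S̄ ⊔ (Ḡ⊥ ⊓ 𝒫(M̄)) = Ḡ⊥` — every bare logical operator times a stabilizer
acts trivially on `M`. [cite: BravyiTerhal2009, §3.1 Lemma 2 (p. 11, case (2))] -/
theorem sup_gaugeStabilizer_bare_compl_eq (hM : IsGaugeCorrectable G M) :
    gaugeStabilizer G ⊔ (sympDual G ⊓ supportedOn Mᶜ) = sympDual G := by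
  have hle : gaugeStabilizer G ⊔ (sympDual G ⊓ supportedOn Mᶜ) ≤ sympDual G :=
    sup_le (gaugeStabilizer_le_sympDual G) inf_le_left
  refine Submodule.eq_of_le_of_finrank_le hle ?_
  -- no dressed logical operator on M: S̄⊥ ∩ 𝒫(M) = Ḡ ∩ 𝒫(M)
  have heq : (sympDual (gaugeStabilizer G) ⊓ supportedOn M : Submodule (ZMod 2) (SympVec n)) =
      G ⊓ supportedOn M :=
    le_antisymm (fun v hv => ⟨hM v hv.1 hv.2, hv.2⟩)
      (inf_le_inf_right _ (le_sympDual_gaugeStabilizer G))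
  have hcount := bareDressed_count G Mᶜ
  rw [compl_compl, heq] at hcount
  -- S̄ ∩ (Ḡ⊥ ∩ 𝒫(M̄)) = S̄ ∩ 𝒫(M̄)
  have hinf : (gaugeStabilizer G ⊓ (sympDual G ⊓ supportedOn Mᶜ) : Submodule (ZMod 2) (SympVec n)) =
      gaugeStabilizer G ⊓ supportedOn Mᶜ := by
    rw [← inf_assoc, inf_eq_left.2 (gaugeStabilizer_le_sympDual G)]
  have hsup := Submodule.finrank_sup_add_finrank_inf_eq (gaugeStabilizer G)
    (sympDual G ⊓ supportedOn Mᶜ : Submodule (ZMod 2) (SympVec n))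
  rw [hinf] at hsup
  omega

/-- **Bravyi–Terhal 2009, Lemma 2 (Cleaning Lemma for Subsystem Codes) — proved, as printed.** «Let `𝒢` be a
gauge group of a subsystem code and `M` be an arbitrary subset of qubits. Then one of the following is true: (1)
There exists a non-trivial logical operator `P ∈ 𝒞(𝒮)∖𝒢` whose support is contained in `M`, (2) For any logical
operator `P ∈ 𝒞(𝒢)` one can choose a stabilizer `S ∈ 𝒮` such that `PS` acts trivially on `M`.» (phases dropped:
`P + s ∈ 𝒫(M̄)`). Column: proved theorem. [cite: BravyiTerhal2009, §3.1 Lemma 2 (p. 11)] -/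
theorem BravyiTerhal2009_lemma2 (G : Submodule (ZMod 2) (SympVec n)) (M : Finset (Fin n)) :
    (∃ P ∈ sympDual (gaugeStabilizer G), P ∉ G ∧ P ∈ supportedOn M) ∨
      (∀ P ∈ sympDual G, ∃ s ∈ gaugeStabilizer G, P + s ∈ supportedOn Mᶜ) := by
  by_cases h1 : ∃ P ∈ sympDual (gaugeStabilizer G), P ∉ G ∧ P ∈ supportedOn M
  · exact Or.inl h1
  · right
    push Not at h1
    have hM : IsGaugeCorrectable G M := fun v hv hvM => by
      by_contra hvG
      exact h1 v hv hvG hvM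
    intro P hP
    have hP' : P ∈ gaugeStabilizer G ⊔ (sympDual G ⊓ supportedOn Mᶜ) := by
      rw [sup_gaugeStabilizer_bare_compl_eq hM]; exact hP
    obtain ⟨s, hs, q, ⟨-, hqM⟩, rfl⟩ := Submodule.mem_sup.1 hP'
    refine ⟨s, hs, ?_⟩
    rw [add_add_cancel_right]
    exact hqM

/-- **Cleaning dressed logical operators with gauge operators** (the form used in Haah–Preskill's Thm. 1 and
Bravyi's §8: `l_bare(M) = 0 ⇒ l(M̄) = 2k`): if no BARE logical operator is supported on `M` (`Ḡ⊥ ∩ 𝒫(M) ⊆ Ḡ`) then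
`Ḡ ⊔ (S̄⊥ ⊓ 𝒫(M̄)) = S̄⊥` — every dressed logical operator is equivalent, up to a gauge operator, to one supported
on `M̄`. [cite: HaahPreskill2012, §3 Lemma 2 and the remark opening p. 6 («if no bare logical operator can be supported on the set M then all dressed logical operators can be supported on its complement»); Bravyi2011Subsystem, §8 («l_bare(A) = 0 … Applying Lemma 2 we get l(B) = 2k»)] -/
theorem sup_gauge_dressed_compl_eq
    (hM : (sympDual G ⊓ supportedOn M : Submodule (ZMod 2) (SympVec n)) ≤ G) :
    G ⊔ (sympDual (gaugeStabilizer G) ⊓ supportedOn Mᶜ) = sympDual (gaugeStabilizer G) := by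
  have hle : G ⊔ (sympDual (gaugeStabilizer G) ⊓ supportedOn Mᶜ) ≤ sympDual (gaugeStabilizer G) :=
    sup_le (le_sympDual_gaugeStabilizer G) inf_le_left
  refine Submodule.eq_of_le_of_finrank_le hle ?_
  -- no bare logical operator on M: Ḡ⊥ ∩ 𝒫(M) = S̄ ∩ 𝒫(M)
  have heq : (sympDual G ⊓ supportedOn M : Submodule (ZMod 2) (SympVec n)) = gaugeStabilizer G ⊓ supportedOn M :=
    le_antisymm (fun v hv => ⟨⟨hM hv, hv.1⟩, hv.2⟩) (inf_le_inf_right _ (gaugeStabilizer_le_sympDual G))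
  have hcount := bareDressed_count G M
  rw [heq] at hcount
  -- Ḡ ∩ (S̄⊥ ∩ 𝒫(M̄)) = Ḡ ∩ 𝒫(M̄)
  have hinf : (G ⊓ (sympDual (gaugeStabilizer G) ⊓ supportedOn Mᶜ) : Submodule (ZMod 2) (SympVec n)) =
      G ⊓ supportedOn Mᶜ := by
    rw [← inf_assoc, inf_eq_left.2 (le_sympDual_gaugeStabilizer G)]
  have hsup := Submodule.finrank_sup_add_finrank_inf_eq G
    (sympDual (gaugeStabilizer G) ⊓ supportedOn Mᶜ : Submodule (ZMod 2) (SympVec n))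
  rw [hinf] at hsup
  have h2 := finrank_sympDual_add G
  have h3 := finrank_sympDual_add (gaugeStabilizer G)
  omega

/-- Element form of the gauge cleaning: no bare logical operator on `M` ⇒ every dressed logical operator `P` has a
gauge operator `y` with `P + y` supported on `M̄` («there exists a gauge operator `y_i` that “cleans” the logical
operator in the hypercube `M_i`»). [cite: HaahPreskill2012, §4 proof of Thm. 1 (p. 8) with §3 Lemma 3] -/
theorem exists_gauge_clean (hM : (sympDual G ⊓ supportedOn M : Submodule (ZMod 2) (SympVec n)) ≤ G)
    {P : SympVec n} (hP : P ∈ sympDual (gaugeStabilizer G)) : ∃ y ∈ G, P + y ∈ supportedOn Mᶜ := by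
  have hP' : P ∈ G ⊔ (sympDual (gaugeStabilizer G) ⊓ supportedOn Mᶜ) := by
    rw [sup_gauge_dressed_compl_eq hM]; exact hP
  obtain ⟨y, hy, q, ⟨-, hqM⟩, rfl⟩ := Submodule.mem_sup.1 hP'
  refine ⟨y, hy, ?_⟩
  rw [add_add_cancel_right]
  exact hqM

/-- A code with `k ≥ 1` logical qubits has a dressed logical operator outside the gauge group (so the whole lattice
is not correctable). [cite: Bravyi2011Subsystem, §6 (p. 11: a code with k logical qubits has 2k independent bare logical operators)] -/
theorem exists_dressed_of_pos {k d : ℕ} (h : IsSubsystemCode G k d) (hk : 1 ≤ k) :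
    ∃ P ∈ sympDual (gaugeStabilizer G), P ∉ G := by
  by_contra hnone
  push Not at hnone
  have hle : sympDual (gaugeStabilizer G) ≤ G := hnone
  have hfin := Submodule.finrank_mono hle
  have h1 := h.1
  have h2 := finrank_sympDual_add G
  have h3 := finrank_sympDual_add (gaugeStabilizer G)
  have h4 := Submodule.finrank_mono (gaugeStabilizer_le G)
  omega

end Cleaning

end Literature.InformationTheory.QuantumCodes
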